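import Mathlib.GroupTheory.Index
import Mathlib.LinearAlgebra.Span.Basic
import Mathlib.NumberTheory.Padics.RingHoms
import HarnessLib

/-!
# Kato 2004, Prop. 14.16 (2) ⊕ Thm. 14.5 (3): the finite-group count behind `#S(T) ≤ ν · #H⁰(ℚ,T⊗ℚ/ℤ) · #H⁰(ℚ,T*(1)⊗ℚ/ℤ)`, PROVED as an abstract skeleton

K. Kato, *`p`-adic Hodge theory and values of zeta functions of modular forms*, Astérisque 295
(2004) [Kato2004Asterisque], proves Prop. 14.16 (p. 244) —

> **Proposition 14.16.** Let `r ∈ ℤ`, `1 ≤ r ≤ k − 1`. In the case `r = k/2`, assume `L(f,k/2) ≠ 0`.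
> Let `T` be a `Gal(ℚ̄/ℚ)`-stable `O_λ`-lattice of `V_{F_λ}(f)(r)`. Then (1) `#(S(T)) = #(S(T*(1)))`.
> (2) … let `γ ∈ V_F(f)`, `± = (−1)^{r−1}`, and assume `γ^±` is an `O_λ`-basis of `T(−r)^±`, and
> let `z ∈ H¹(ℤ[1/p],V_{F_λ}(f)(r))` be the image of `z_γ^{(p)}` under (14.13.1). Then
> `#(S(T)) = μ⁻¹ · ν · #(H⁰(ℚ,T⊗ℚ/ℤ)) · #(H⁰(ℚ,T*(1)⊗ℚ/ℤ))` where
> `μ = [H¹(ℤ[1/p],T) : z] · #(H²(ℤ[1/p],T))⁻¹`, `ν = [H¹(ℚ_p,T)/H¹_f(ℚ_p,T) : z] · #(H²(ℚ_p,T))⁻¹`.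

— on p. 245 by counting orders along the Poitou–Tate sequence (14.9.3) (p. 240)

  `0 → H¹(ℤ[1/p],T)/H¹_f(ℤ[1/p],T) →ᵃ H¹(ℚ_p,T)/H¹_f(ℚ_p,T) → S(T*(1))^∨ → H²(ℤ[1/p],T) → H²(ℚ_p,T)
     → H⁰(ℤ[1/p],T*(1)⊗ℚ/ℤ)^∨ → 0`

("exact in the case `p ≠ 2`"), using that `H¹_f(ℤ[1/p],T)` is the torsion part
`H⁰(ℚ,T⊗ℚ/ℤ)` of `H¹(ℤ[1/p],T)` (p. 244, last lines). Thm. 14.5 (3) (p. 236; for `p ≠ 2`, `f`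
potentially good at `p`, Kato's (12.5.2), `γ^±` a basis) is the inequality
`#(H²(ℤ[1/p],T)) ≤ [H¹(ℤ[1/p],T) : z]`, i.e. `μ ≥ 1`, whence
`#S(T*(1)) ≤ ν · #H⁰(ℚ,T⊗ℚ/ℤ) · #H⁰(ℚ,T*(1)⊗ℚ/ℤ)` — the step that the residual cell `b2b-bsdres`
(seat additive-p4, named fact
`Literature.NumberTheory.EllipticCurves.Kato2004.rankZero_padicValNat_sha_le_of_additive_potGood_of_imageContainsSL2`,
file `Kato2004/AdditivePotGoodRankZeroShaUpperBound.lean`) inserts between the two printed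
statements to obtain `ord_p #Ш(E/ℚ)[p^∞] ≤ ord_p(L(E,1)/Ω_E)` at an additive potentially good
`p ≠ 2` (for `T = T_pE` one has `T*(1) ≅ T`, so `S(T*(1)) = S(T) ⊇ Sel(T) = Ш[p^∞]` in rank `0`).

None of Kato's objects (`H^q(ℤ[1/p],T)`, `S(T)`, `H¹_f`, the zeta element `z`, the dual
exponential) exists in the tree, and NONE is assumed here as a named fact (D-0026). This file
PROVES the finite-group bookkeeping with the six-term sequence as an explicit hypothesis on
abstract abelian groups / modules `H` (`= H¹(ℤ[1/p],T)`, NOT its torsion-free quotient: the map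
`a` below starts from `H` and has kernel `H₀ = H¹_f(ℤ[1/p],T)`), `B` (`= H¹(ℚ_p,T)/H¹_f(ℚ_p,T)`),
`C` (`= S(T*(1))^∨`), `D` (`= H²(ℤ[1/p],T)`), `E` (`= H²(ℚ_p,T)`), `F` (`= H⁰(ℤ[1/p],T*(1)⊗ℚ/ℤ)^∨`):

* `Kato2004.card_mul_card_eq_of_sixTerm` — (14.16.1)–(14.16.3) in one line: for
  `H →ᵃ B → C → D → E → F → 0` exact at `B, C, D, E` with the last map onto,
  `#C · #E = [B : a(H)] · #D · #F` (`Nat.card`, unconditionally: an infinite group has `Nat.card = 0`).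
* `Kato2004.card_mul_index_span_map_eq` — Kato's index versus the torsion:
  `#H₀ · [B : O·a(z)] = [H : O·z] · [B : a(H)]` when `ker a = H₀` is finite and `O·z ∩ H₀ = 0`
  (so `[H : z] = #H⁰(ℚ,T⊗ℚ/ℤ) · [H/H₀ : z̄]`, the identity used on p. 244).
* `Kato2004.card_mul_card_le_of_sixTerm_of_card_le_index` — **the skeleton of "14.16 (2) + 14.5 (3)"**:
  the sequence data plus the single inequality `#D ≤ [H : O·z]` (= Thm. 14.5 (3)) give
  `#C · #E ≤ [B : O·a(z)] · #H₀ · #F`, i.e.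
  `#S(T*(1)) · #H²(ℚ_p,T) ≤ [H¹(ℚ_p,T)/H¹_f : z] · #H⁰(ℚ,T⊗ℚ/ℤ) · #H⁰(ℚ,T*(1)⊗ℚ/ℤ)`.
* `Kato2004.index_span_singleton_eq_pow_of_equiv` (with the private `index_span_singleton_padicInt`) — the
  numeric tail for `O = ℤ_p`: in a free rank-one `ℤ_p`-module with coordinate `e`,
  `[B : ℤ_p·w] = p ^ v(e w)`; and `Kato2004.card_le_pow_of_sixTerm` — with `#E = p^t` and
  `[B : ℤ_p·a(z)] = p^(t+m)` the `p^t` cancels: `#C ≤ p^m · #H₀ · #F` (in the application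
  `t = length E(ℚ_p)[p^∞]`, `p^(t+m) = [exp*_{ω_E}(H¹(ℚ_p,T)) : exp*_{ω_E}(z)]`, and `#H₀ = #F = 1`
  when `E[p]` is irreducible, giving `#Ш[p^∞] ≤ #S(T) ≤ p^m`).

So the only non-kernel content of the cell's reading is the IDENTIFICATION of Kato's objects with
the elliptic-curve quantities (Kato §14.1, §14.8–14.10, Thm. 12.5 (1); C.-H. Kim, AJM 148 (2026)
§3.2), not the count. Companion of `Literature/NumberTheory/EllipticCurves/KatoDivisibilitySkeletonProofs.lean`
(the same service for §17.13 / Thm. 17.4). Theorems only: no definition, no named fact, no `sorry`.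

What is deliberately NOT here: the exactness "up to `×2`" at `p = 2`; clause (1) of Prop. 14.16
(not needed for a self-dual `T`); Lemma 14.15 and §14.17–14.18 (Fontaine–Laffaille evaluation of `ν`
at a GOOD prime — the additive-prime evaluation used by the cell is Kim's Lemma 3.10 instead).

References: K. Kato, Astérisque 295 (2004), Thm. 14.5 (pp. 236–237), §14.8 (p. 238), (14.9.3)
(p. 240), Prop. 14.16 and its proof (pp. 244–245) [Kato2004Asterisque]; C.-H. Kim, Amer. J. Math.
148 (2026) 79–129, §3.2.1–3.2.3, Lemma 3.10 [Kim2022StructureSelmer].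
-/

namespace Literature.NumberTheory.EllipticCurves

namespace Kato2004

/-! ### The six-term count (14.16.1)–(14.16.3) -/

section SixTerm

variable {H B C D E F : Type*} [AddCommGroup H] [AddCommGroup B] [AddCommGroup C]
  [AddCommGroup D] [AddCommGroup E] [AddCommGroup F]

/-- **Order count along a six-term exact sequence** (the content of (14.16.1)–(14.16.3) in the
proof of Kato, Astérisque 295, Prop. 14.16, p. 245, read on the Poitou–Tate sequence (14.9.3),
p. 240): if `H →ᵃ B →ᶠ² C →ᶠ³ D →ᶠ⁴ E →ᶠ⁵ F` is exact at `B`, `C`, `D`, `E` and `f₅` is onto, then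
`#C · #E = [B : a(H)] · #D · #F`. Stated with `Nat.card` and `AddSubgroup.index`, hence valid
verbatim without finiteness hypotheses (an infinite group has `Nat.card = 0`, an infinite index is
`0`). In Kato's notation: `#S(T*(1))^∨ · #H²(ℚ_p,T) = #Coker(a) · #H²(ℤ[1/p],T) · #H⁰(ℤ[1/p],T*(1)⊗ℚ/ℤ)`.
[cite: Kato2004Asterisque, Prop. 14.16, proof, (14.16.1)–(14.16.3), p. 245] -/
theorem card_mul_card_eq_of_sixTerm (a : H →+ B) (f₂ : B →+ C) (f₃ : C →+ D) (f₄ : D →+ E)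
    (f₅ : E →+ F) (h₂ : f₂.ker = a.range) (h₃ : f₃.ker = f₂.range) (h₄ : f₄.ker = f₃.range)
    (h₅ : f₅.ker = f₄.range) (h₅s : Function.Surjective f₅) :
    Nat.card C * Nat.card E = a.range.index * Nat.card D * Nat.card F := by
  -- `#C = #ker f₃ · [C : ker f₃] = #range f₂ · #range f₃`
  have hC : Nat.card C = Nat.card f₂.range * Nat.card f₃.range := by
    rw [← AddSubgroup.card_mul_index f₃.ker, AddSubgroup.index_ker, h₃]
  -- `#range f₂ = [B : ker f₂] = [B : range a]`
  have hf₂ : Nat.card f₂.range = a.range.index := by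
    rw [← AddSubgroup.index_ker, h₂]
  -- `#D = #range f₃ · #range f₄`
  have hD : Nat.card D = Nat.card f₃.range * Nat.card f₄.range := by
    rw [← AddSubgroup.card_mul_index f₄.ker, AddSubgroup.index_ker, h₄]
  -- `#E = #range f₄ · #F`
  have hE : Nat.card E = Nat.card f₄.range * Nat.card F := by
    rw [← AddSubgroup.card_mul_index f₅.ker, AddSubgroup.index_ker, h₅,
      AddMonoidHom.range_eq_top.mpr h₅s, AddSubgroup.card_top]
  rw [hC, hf₂, hD, hE]
  ring

/-- The inequality form: under the hypotheses of `card_mul_card_eq_of_sixTerm`, any upper bound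
`#D ≤ ι` gives `#C · #E ≤ [B : a(H)] · ι · #F`. (With `ι = [H¹(ℤ[1/p],T) : z]` this is how Kato's
Thm. 14.5 (3), `#H²(ℤ[1/p],T) ≤ [H¹(ℤ[1/p],T) : z]`, enters Prop. 14.16 (2).)
[cite: Kato2004Asterisque, Thm. 14.5 (3) (p. 236) with Prop. 14.16 (2) (p. 244)] -/
theorem card_mul_card_le_of_sixTerm (a : H →+ B) (f₂ : B →+ C) (f₃ : C →+ D) (f₄ : D →+ E)
    (f₅ : E →+ F) (h₂ : f₂.ker = a.range) (h₃ : f₃.ker = f₂.range) (h₄ : f₄.ker = f₃.range)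
    (h₅ : f₅.ker = f₄.range) (h₅s : Function.Surjective f₅) {ι : ℕ} (hD : Nat.card D ≤ ι) :
    Nat.card C * Nat.card E ≤ a.range.index * ι * Nat.card F := by
  rw [card_mul_card_eq_of_sixTerm a f₂ f₃ f₄ f₅ h₂ h₃ h₄ h₅ h₅s]
  gcongr

end SixTerm

/-! ### Kato's index `[H : z]` versus the torsion part of `H` -/

section Index

variable {O : Type*} [Ring O] {H B : Type*} [AddCommGroup H] [Module O H] [AddCommGroup B]
  [Module O B]

/-- For additive subgroups `S, H₀` of an abelian group with `S ⊓ H₀ = ⊥` and `H₀` arbitrary: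
`[H : S] = #H₀ · [H : S ⊔ H₀]` (`Nat.card`/`index` conventions). [folklore] -/
private theorem index_eq_card_mul_index_sup {G : Type*} [AddCommGroup G] (S H₀ : AddSubgroup G)
    (hS : S ⊓ H₀ = ⊥) : S.index = Nat.card H₀ * (S ⊔ H₀).index := by
  rw [← AddSubgroup.relIndex_mul_index (le_sup_left : S ≤ S ⊔ H₀), AddSubgroup.relIndex_sup_left,
    ← AddSubgroup.inf_relIndex_right, hS, AddSubgroup.relIndex_bot_left]

/-- **Kato's index and the torsion part** (Astérisque 295, p. 244, last three lines: "`H¹_f(ℤ[1/p],T)`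
coincides with the torsion part `H⁰(ℚ,T⊗ℚ/ℤ)` of `H¹(ℤ[1/p],T)`", used to pass between
`[H¹(ℤ[1/p],T) : z]` and the index of `z̄` in the torsion-free quotient). Abstractly: for an
`O`-linear map `a : H → B` with kernel `H₀` and an element `z ∈ H` whose span meets `H₀`
trivially, `#H₀ · [B : O·a(z)] = [H : O·z] · [B : a(H)]`. [cite: Kato2004Asterisque, Prop. 14.16, proof, p. 244] -/
theorem card_mul_index_span_map_eq (a : H →ₗ[O] B) (H₀ : Submodule O H)
    (hker : LinearMap.ker a = H₀) (z : H) (hz : (O ∙ z) ⊓ H₀ = ⊥) :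
    Nat.card H₀ * (O ∙ a z).toAddSubgroup.index =
      (O ∙ z).toAddSubgroup.index * (LinearMap.range a).toAddSubgroup.index := by
  -- `O·a(z) = a(O·z)` and `[B : a(S)] = [H : S ⊔ ker a] · [B : a(H)]`
  have hmap : (O ∙ a z) = (O ∙ z).map a := by
    rw [Submodule.map_span, Set.image_singleton]
  have hk : (a : H →+ B).ker = H₀.toAddSubgroup := by
    ext x
    rw [← hker]
    simp
  have hr : (a : H →+ B).range = (LinearMap.range a).toAddSubgroup := by
    ext x
    simp
  have hidx : (O ∙ a z).toAddSubgroup.index =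
      ((O ∙ z).toAddSubgroup ⊔ H₀.toAddSubgroup).index * (LinearMap.range a).toAddSubgroup.index := by
    rw [hmap, Submodule.map_toAddSubgroup, AddSubgroup.index_map, hk, hr]
  -- `[H : O·z] = #H₀ · [H : O·z ⊔ H₀]`
  have hinf : (O ∙ z).toAddSubgroup ⊓ H₀.toAddSubgroup = ⊥ := by
    have h := congrArg Submodule.toAddSubgroup hz
    rw [Submodule.bot_toAddSubgroup] at h
    rw [← h]
    ext x
    simp [AddSubgroup.mem_inf]
  have hcard : Nat.card H₀.toAddSubgroup = Nat.card H₀ := rfl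
  rw [hidx, index_eq_card_mul_index_sup _ _ hinf, hcard]
  ring

/-- **Skeleton of Kato's Prop. 14.16 (2) ⊕ Thm. 14.5 (3)** (Astérisque 295, pp. 236, 244–245).
Data: an `O`-linear `a : H → B` with finite kernel `H₀` (`= H¹_f(ℤ[1/p],T) = H⁰(ℚ,T⊗ℚ/ℤ)` inside
`H = H¹(ℤ[1/p],T)`, `B = H¹(ℚ_p,T)/H¹_f(ℚ_p,T)`), additive maps `B → C → D → E → F` continuing it
to a sequence exact at `B, C, D, E` with the last map onto (`C = S(T*(1))^∨`, `D = H²(ℤ[1/p],T)`,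
`E = H²(ℚ_p,T)`, `F = H⁰(ℤ[1/p],T*(1)⊗ℚ/ℤ)^∨`; this is (14.9.3), exact for `p ≠ 2`), an element
`z ∈ H` (the zeta element) whose `O`-span meets `H₀` trivially, and THE ONE INEQUALITY
`#D ≤ [H : O·z]` (Thm. 14.5 (3): `#H²(ℤ[1/p],T) ≤ [H¹(ℤ[1/p],T) : z]`, i.e. `μ ≥ 1`).
Conclusion: `#C · #E ≤ [B : O·a(z)] · #H₀ · #F`, i.e.
`#S(T*(1)) · #H²(ℚ_p,T) ≤ [H¹(ℚ_p,T)/H¹_f(ℚ_p,T) : z] · #H⁰(ℚ,T⊗ℚ/ℤ) · #H⁰(ℚ,T*(1)⊗ℚ/ℤ)`,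
which is Kato's `#S(T) = μ⁻¹ ν #H⁰ #H⁰` combined with `μ ≥ 1` (and (1) `#S(T) = #S(T*(1))`, trivial
for a self-dual `T`). [cite: Kato2004Asterisque, Prop. 14.16 (2) (p. 244) with Thm. 14.5 (3) (p. 236)] -/
theorem card_mul_card_le_of_sixTerm_of_card_le_index {C D E F : Type*} [AddCommGroup C]
    [AddCommGroup D] [AddCommGroup E] [AddCommGroup F] (a : H →ₗ[O] B) (f₂ : B →+ C)
    (f₃ : C →+ D) (f₄ : D →+ E) (f₅ : E →+ F) (H₀ : Submodule O H) [Finite H₀]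
    (hker : LinearMap.ker a = H₀) (h₂ : f₂.ker = a.toAddMonoidHom.range)
    (h₃ : f₃.ker = f₂.range) (h₄ : f₄.ker = f₃.range) (h₅ : f₅.ker = f₄.range)
    (h₅s : Function.Surjective f₅) (z : H) (hz : (O ∙ z) ⊓ H₀ = ⊥)
    (h145 : Nat.card D ≤ (O ∙ z).toAddSubgroup.index) :
    Nat.card C * Nat.card E ≤ (O ∙ a z).toAddSubgroup.index * Nat.card H₀ * Nat.card F := by
  have hsix := card_mul_card_le_of_sixTerm a.toAddMonoidHom f₂ f₃ f₄ f₅ h₂ h₃ h₄ h₅ h₅s h145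
  have hrange : a.toAddMonoidHom.range = (LinearMap.range a).toAddSubgroup :=
    (LinearMap.range_toAddSubgroup a).symm
  have hkey := card_mul_index_span_map_eq a H₀ hker z hz
  -- `[B : a(H)] · [H : O·z] · #F = #H₀ · [B : O·a(z)] · #F`
  calc Nat.card C * Nat.card E
      ≤ a.toAddMonoidHom.range.index * (O ∙ z).toAddSubgroup.index * Nat.card F := hsix
    _ = Nat.card H₀ * (O ∙ a z).toAddSubgroup.index * Nat.card F := by
        rw [hrange, mul_comm (LinearMap.range a).toAddSubgroup.index, ← hkey]
    _ = (O ∙ a z).toAddSubgroup.index * Nat.card H₀ * Nat.card F := by ring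

end Index

/-! ### The numeric tail over `O = ℤ_p` -/

section PadicTail

variable (p : ℕ) [Fact p.Prime]

/-- In `ℤ_p` the index of the ideal generated by a non-zero `x` is `p ^ v(x)`. [folklore] -/
private theorem index_span_singleton_padicInt (x : ℤ_[p]) (hx : x ≠ 0) :
    (Ideal.span {x} : Ideal ℤ_[p]).toAddSubgroup.index = p ^ x.valuation := by
  have hspan : (Ideal.span {x} : Ideal ℤ_[p]) = Ideal.span {(p : ℤ_[p]) ^ x.valuation} := by
    conv_lhs => rw [PadicInt.unitCoeff_spec hx]
    exact Ideal.span_singleton_mul_left_unit (PadicInt.unitCoeff hx).isUnit _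
  have hsurj : Function.Surjective (PadicInt.toZModPow x.valuation : ℤ_[p] →+* ZMod (p ^ x.valuation)) := by
    intro y
    refine ⟨(y.val : ℤ_[p]), ?_⟩
    rw [map_natCast, ZMod.natCast_zmod_val]
  rw [hspan, ← PadicInt.ker_toZModPow]
  change (PadicInt.toZModPow x.valuation : ℤ_[p] →+* ZMod (p ^ x.valuation)).toAddMonoidHom.ker.index = _
  rw [AddSubgroup.index_ker, AddMonoidHom.range_eq_top.mpr hsurj, AddSubgroup.card_top, Nat.card_zmod]

/-- **Kato's index in a free rank-one `ℤ_p`-module with a coordinate.** If `e : B ≃ ℤ_p` is a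
`ℤ_p`-linear coordinate (in the application: `B = H¹(ℚ_p,T)/H¹_f(ℚ_p,T)` and `e` = the dual
exponential `exp*_{ω_E}` rescaled so that its image `c_p p^{-t} ℤ_p` (C.-H. Kim, AJM 148 (2026),
§3.2.3, display "As in Lemma 3.4, if `p > 2` …"; Lemma 3.10) becomes `ℤ_p`), then for `w ≠ 0`
the index `[B : ℤ_p·w]` is `p ^ v(e w)`. [cite: Kim2022StructureSelmer, §3.2.3 and Lemma 3.10 (PDF pp. 16–17)] -/
theorem index_span_singleton_eq_pow_of_equiv {B : Type*} [AddCommGroup B] [Module ℤ_[p] B]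
    (e : B ≃ₗ[ℤ_[p]] ℤ_[p]) (w : B) (hw : w ≠ 0) :
    (ℤ_[p] ∙ w).toAddSubgroup.index = p ^ (e w).valuation := by
  have hne : e w ≠ 0 := fun h => hw (e.map_eq_zero_iff.mp h)
  have hmap : (ℤ_[p] ∙ e w) = (ℤ_[p] ∙ w).map (e : B →ₗ[ℤ_[p]] ℤ_[p]) := by
    rw [Submodule.map_span, Set.image_singleton]; rfl
  have hidx : (ℤ_[p] ∙ e w).toAddSubgroup.index = (ℤ_[p] ∙ w).toAddSubgroup.index := by
    rw [hmap, Submodule.map_toAddSubgroup]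
    exact AddSubgroup.index_map_of_bijective (f := (e : B →ₗ[ℤ_[p]] ℤ_[p]).toAddMonoidHom)
      e.bijective _
  rw [← hidx]
  exact index_span_singleton_padicInt p (e w) hne

/-- **The cancellation of `#H²(ℚ_p,T) = p^t`.** If, in the situation of
`card_mul_card_le_of_sixTerm_of_card_le_index`, `#E = p^t` (local Tate duality:
`#H²(ℚ_p,T_pE) = #E(ℚ_p)[p^∞] = p^t`, Kato §14.9) and `[B : ℤ_p·a(z)] = p^(t+m)` (Kim's lattice
`exp*_{ω_E}(H¹(ℚ_p,T)) = c_p p^{-t}ℤ_p` containing `exp*_{ω_E}(z) = 2L(E,1)/Ω_E`, so that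
`t + m = t + ord_p(L(E,1)/Ω_E) − v_p(c_p)` for odd `p`), then `#C ≤ p^m · #H₀ · #F`; with `E[p]`
irreducible both torsion terms are `1` and this reads `#S(T) ≤ p^m`, whence
`ord_p #Ш(E/ℚ)[p^∞] ≤ m` in analytic rank `0`. Pure arithmetic on top of the skeleton.
[cite: Kato2004Asterisque, Prop. 14.16 (2) (p. 244), Thm. 14.5 (3) (p. 236), §14.9 (p. 239)] -/
theorem card_le_pow_of_sixTerm {C E : Type*} {t m ι h₀ f : ℕ} (hE : Nat.card E = p ^ t)
    (hι : ι = p ^ (t + m)) (hle : Nat.card C * Nat.card E ≤ ι * h₀ * f) :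
    Nat.card C ≤ p ^ m * h₀ * f := by
  have hp : 0 < p ^ t := pow_pos (Nat.Prime.pos Fact.out) t
  rw [hE, hι, pow_add] at hle
  have : Nat.card C * p ^ t ≤ (p ^ m * h₀ * f) * p ^ t := by
    calc Nat.card C * p ^ t ≤ p ^ t * p ^ m * h₀ * f := hle
      _ = (p ^ m * h₀ * f) * p ^ t := by ring
  exact Nat.le_of_mul_le_mul_right this hp

/-- **Last link: from `#S(T) ≤ p^m` to `ord_p #Ш ≤ m`.** If a group `Sel` (`= Sel(T) = Ш(E/ℚ)[p^∞]`
in analytic rank `0`, Kato §14.1) sits inside `S` (`Sel(T) ⊂ S(T)`, Kato §14.8, p. 238) with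
`#S ≤ p^m`, and `#Sel = p^s`, then `s ≤ m`. [cite: Kato2004Asterisque, §14.8 (p. 238) with Prop. 14.16 (2) (p. 244)] -/
theorem exponent_le_of_card_le_pow {S : Type*} [AddCommGroup S] [Finite S] (Sel : AddSubgroup S)
    {s m : ℕ} (hSel : Nat.card Sel = p ^ s) (hS : Nat.card S ≤ p ^ m) : s ≤ m := by
  have hle : p ^ s ≤ p ^ m :=
    hSel ▸ (Nat.le_of_dvd (Nat.card_pos) (AddSubgroup.card_addSubgroup_dvd_card Sel)).trans hS
  exact (Nat.pow_le_pow_iff_right (Nat.Prime.one_lt Fact.out)).mp hle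

end PadicTail

end Kato2004

end Literature.NumberTheory.EllipticCurves
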